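import Summits.Ventures.Crystal3D.StickySpheres.ExtensionStep
import Summits.Ventures.Crystal3D.StickySpheres.ContactEight
import Mathlib.Combinatorics.SimpleGraph.Connectivity.Connected
import Mathlib.Data.Finset.Sort
import HarnessLib

/-!
# Connected complete lists suffice: a disconnected relaxed-realisable graph splits into two packings

Venture `Crystal3D` (cell `pub-crystal3d`, seat p3). The enumeration engines sweep CONNECTED graphs (`geng -c`), while
`CompleteListHypothesis d e n L` (and `GraphStratumHypothesis`) quantify over all graphs. This file closes that gap
formally (REDUCTIONS.md fact (F4)):

* `CompleteListHypothesisConn d e n L` — the complete-list statement restricted to connected graphs (literally what a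
  `geng -c -d<d> n e:e` sweep with relaxed-semantics refutations certifies);
* `RelaxedRealisable.exists_split_of_not_connected` — a relaxed-realisable graph on `n ≥ 1` vertices that is NOT connected
  has a vertex class `A` (`0 < |A| = a < n`) with no edges leaving it, and then `|E| ≤ C(a) + C(n − a)` (both sides are
  packings): `RelaxedRealisable.card_edgeFinset_le_add_of_not_connected`;
* `CompleteListHypothesis.of_conn` — if `e > C(a) + C(n − a)` for every `0 < a < n`, the connected statement implies the
  full one.
HONEST FRAMING: [folklore] bookkeeping; the bound `e > max_a C(a) + C(n−a)` must be supplied (from the table rows).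
-/

namespace Summit.Ventures.Crystal3D

open Finset SimpleGraph

/-- **Complete list over connected graphs**: every CONNECTED relaxed-realisable graph on `Fin n` with `e` edges and minimum
degree `≥ d` is isomorphic to a member of `L`. [folklore] -/
def CompleteListHypothesisConn (d e n : ℕ) (L : Set (SimpleGraph (Fin n))) : Prop :=
  ∀ G : SimpleGraph (Fin n), ∀ [DecidableRel G.Adj], G.Connected →
    G.edgeFinset.card = e → (∀ i, d ≤ G.degree i) → RelaxedRealisable G → ∃ H ∈ L, Nonempty (G ≃g H)

/-- The unrestricted statement implies the connected one. [folklore] -/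
theorem CompleteListHypothesis.conn {d e n : ℕ} {L : Set (SimpleGraph (Fin n))} (h : CompleteListHypothesis d e n L) :
    CompleteListHypothesisConn d e n L :=
  fun G _ _ he hd hG => h G he hd hG

section Split

variable {n : ℕ} (G : SimpleGraph (Fin n)) [DecidableRel G.Adj]

/-- Degrees are preserved when a vertex class closed under adjacency is enumerated: if every neighbour of `f i` lies in
the range of the injective map `f`, then `deg_{G.comap f} i = deg_G (f i)`. [folklore] -/
theorem degree_comap_eq_of_closed {a : ℕ} (f : Fin a ↪ Fin n)
    (hclosed : ∀ i v, G.Adj (f i) v → v ∈ Set.range f) (i : Fin a) :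
    (G.comap f).degree i = G.degree (f i) := by
  rw [← card_neighborFinset_eq_degree, ← card_neighborFinset_eq_degree, ← Finset.card_map f]
  congr 1
  ext v
  simp only [Finset.mem_map, mem_neighborFinset, comap_adj]
  constructor
  · rintro ⟨j, hj, rfl⟩
    exact hj
  · intro hv
    obtain ⟨j, rfl⟩ := hclosed i v hv
    exact ⟨j, hv, rfl⟩

/-- Edge count of an adjacency-closed class: `2 |E(G.comap f)| = Σ_{v ∈ range f} deg_G v`. [folklore] -/
theorem two_mul_card_edgeFinset_comap_of_closed {a : ℕ} (f : Fin a ↪ Fin n)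
    (hclosed : ∀ i v, G.Adj (f i) v → v ∈ Set.range f) :
    2 * (G.comap f).edgeFinset.card = ∑ v ∈ Finset.univ.map f, G.degree v := by
  rw [← sum_degrees_eq_twice_card_edges, Finset.sum_map]
  exact Finset.sum_congr rfl fun i _ => degree_comap_eq_of_closed G f hclosed i

end Split

/-- **(F4) A disconnected relaxed-realisable graph splits into two packings:** if `G` on `n ≥ 1` vertices with all
degrees `≥ d` is relaxed-realisable and not connected, then for some `a` with `d + 1 ≤ a` and `d + 1 ≤ n − a` (each class
contains a vertex together with its `≥ d` neighbours), `|E(G)| ≤ C(a) + C(n − a)`. [folklore] -/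
theorem RelaxedRealisable.card_edgeFinset_le_add_of_not_connected {n d : ℕ} {G : SimpleGraph (Fin n)}
    [DecidableRel G.Adj] (hG : RelaxedRealisable G) (hn : 0 < n) (hd : ∀ i, d ≤ G.degree i) (hconn : ¬ G.Connected) :
    ∃ a, d + 1 ≤ a ∧ d + 1 ≤ n - a ∧ G.edgeFinset.card ≤ maxContacts 3 a + maxContacts 3 (n - a) := by
  classical
  -- two vertices in different components
  have hne : Nonempty (Fin n) := ⟨⟨0, hn⟩⟩
  have hnp : ¬ G.Preconnected := fun hp => hconn ⟨hp⟩
  simp only [Preconnected, not_forall] at hnp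
  obtain ⟨u, v, huv⟩ := hnp
  -- the class of `u`
  set A : Finset (Fin n) := Finset.univ.filter fun w => G.Reachable u w with hA
  have huA : u ∈ A := by simp [hA]
  have hvA : v ∉ A := by simp [hA, huv]
  set a := A.card with ha
  -- `A` is closed under adjacency
  have hAclosed : ∀ w w', w ∈ A → G.Adj w w' → w' ∈ A := by
    intro w w' hw hww'
    simp only [hA, Finset.mem_filter, Finset.mem_univ, true_and] at hw ⊢
    exact hw.trans hww'.reachable
  set B : Finset (Fin n) := Aᶜ with hB
  have hBcard : B.card = n - a := by rw [hB, Finset.card_compl, Fintype.card_fin]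
  have hvB : v ∈ B := by rw [hB, Finset.mem_compl]; exact hvA
  have hBclosed : ∀ w w', w ∈ B → G.Adj w w' → w' ∈ B := by
    intro w w' hw hww'
    rw [hB, Finset.mem_compl] at hw ⊢
    exact fun h => hw (hAclosed _ _ h hww'.symm)
  -- each class contains a closed neighbourhood, hence has `≥ d + 1` elements
  have hbig : ∀ (C : Finset (Fin n)) (w : Fin n), w ∈ C → (∀ w', G.Adj w w' → w' ∈ C) → d + 1 ≤ C.card := by
    intro C w hw hcl
    have hsub : insert w (G.neighborFinset w) ⊆ C := by
      intro z hz
      rcases Finset.mem_insert.1 hz with rfl | hz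
      · exact hw
      · exact hcl z ((mem_neighborFinset _ _ _).1 hz)
    have h1 := Finset.card_le_card hsub
    rw [Finset.card_insert_of_notMem (G.notMem_neighborFinset_self w), card_neighborFinset_eq_degree] at h1
    have h2 := hd w
    omega
  have ha0 : d + 1 ≤ a := hbig A u huA (fun w' h => hAclosed u w' huA h)
  have han : d + 1 ≤ n - a := hBcard ▸ hbig B v hvB (fun w' h => hBclosed v w' hvB h)
  let fA : Fin a ↪ Fin n := (A.orderEmbOfFin ha.symm).toEmbedding
  let fB : Fin (n - a) ↪ Fin n := (B.orderEmbOfFin hBcard).toEmbedding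
  have hfA : ∀ i, fA i ∈ A := fun i => A.orderEmbOfFin_mem ha.symm i
  have hfB : ∀ j, fB j ∈ B := fun j => B.orderEmbOfFin_mem hBcard j
  have hrangeA : Set.range fA = (A : Set (Fin n)) := A.range_orderEmbOfFin ha.symm
  have hrangeB : Set.range fB = (B : Set (Fin n)) := B.range_orderEmbOfFin hBcard
  -- adjacency-closedness along the enumerations
  have hclA : ∀ i w, G.Adj (fA i) w → w ∈ Set.range fA := by
    intro i w h
    rw [hrangeA]
    exact hAclosed _ _ (hfA i) h
  have hclB : ∀ j w, G.Adj (fB j) w → w ∈ Set.range fB := by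
    intro j w h
    rw [hrangeB]
    exact hBclosed _ _ (hfB j) h
  -- edge count splits
  have hsum : 2 * G.edgeFinset.card = 2 * (G.comap fA).edgeFinset.card + 2 * (G.comap fB).edgeFinset.card := by
    rw [two_mul_card_edgeFinset_comap_of_closed G fA hclA, two_mul_card_edgeFinset_comap_of_closed G fB hclB,
      ← sum_degrees_eq_twice_card_edges]
    have hmapA : Finset.univ.map fA = A := by
      ext w
      simp only [Finset.mem_map, Finset.mem_univ, true_and]
      constructor
      · rintro ⟨i, rfl⟩; exact hfA i
      · intro hw
        have : w ∈ Set.range fA := by rw [hrangeA]; exact hw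
        obtain ⟨i, rfl⟩ := this
        exact ⟨i, rfl⟩
    have hmapB : Finset.univ.map fB = B := by
      ext w
      simp only [Finset.mem_map, Finset.mem_univ, true_and]
      constructor
      · rintro ⟨j, rfl⟩; exact hfB j
      · intro hw
        have : w ∈ Set.range fB := by rw [hrangeB]; exact hw
        obtain ⟨j, rfl⟩ := this
        exact ⟨j, rfl⟩
    rw [hmapA, hmapB, hB, Finset.sum_add_sum_compl]
  -- both classes are packings
  have h1 := (RelaxedRealisable.of_le_comap fA fA.injective le_rfl hG).card_edgeFinset_le_maxContacts
  have h2 := (RelaxedRealisable.of_le_comap fB fB.injective le_rfl hG).card_edgeFinset_le_maxContacts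
  exact ⟨a, ha0, han, by omega⟩

/-- **Connected complete lists suffice** when the stratum is too dense to split: if `e > C(a) + C(n − a)` whenever
`d + 1 ≤ a` and `d + 1 ≤ n − a`, then `CompleteListHypothesisConn d e n L → CompleteListHypothesis d e n L`. [folklore] -/
theorem CompleteListHypothesis.of_conn {d e n : ℕ} {L : Set (SimpleGraph (Fin n))} (hn : 0 < n)
    (hdense : ∀ a, d + 1 ≤ a → d + 1 ≤ n - a → maxContacts 3 a + maxContacts 3 (n - a) < e)
    (h : CompleteListHypothesisConn d e n L) : CompleteListHypothesis d e n L := by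
  intro G _ he hd hG
  by_cases hconn : G.Connected
  · exact h G hconn he hd hG
  · obtain ⟨a, ha0, han, hle⟩ := hG.card_edgeFinset_le_add_of_not_connected hn hd hconn
    have := hdense a ha0 han
    omega

/-- The same for an empty list: a connected-only kill sweep proves the graph stratum empty when the stratum is too dense
to split. [folklore] -/
theorem graphStratumHypothesis_of_conn {d e n : ℕ} (hn : 0 < n)
    (hdense : ∀ a, d + 1 ≤ a → d + 1 ≤ n - a → maxContacts 3 a + maxContacts 3 (n - a) < e)
    (h : CompleteListHypothesisConn d e n ∅) : GraphStratumHypothesis d e n :=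
  completeListHypothesis_empty_iff.1 (CompleteListHypothesis.of_conn hn hdense h)

/-! ### The strata used by the cone certificates are too dense to split (tree values `C(4..8)` only) -/

/-- The density check for the strata used in this directory, from the unconditional values `C(4) = 6`, `C(5) = 9`,
`C(6) = 12`, `C(7) = 15`, `C(8) = 18`: `(d, e, n) ∈ {(3,18,8), (4,21,9), (4,22,9), (3,24,10), (3,25,10), (5,26,10), (4,29,11),
(5,30,11), (3,32,12), (3,33,12), (5,34,12), (4,37,13)}`. [folklore] -/
theorem dense_strata :
    (∀ a, 3 + 1 ≤ a → 3 + 1 ≤ 8 - a → maxContacts 3 a + maxContacts 3 (8 - a) < 18) ∧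
    (∀ a, 4 + 1 ≤ a → 4 + 1 ≤ 9 - a → maxContacts 3 a + maxContacts 3 (9 - a) < 21) ∧
    (∀ a, 3 + 1 ≤ a → 3 + 1 ≤ 10 - a → maxContacts 3 a + maxContacts 3 (10 - a) < 24) ∧
    (∀ a, 4 + 1 ≤ a → 4 + 1 ≤ 11 - a → maxContacts 3 a + maxContacts 3 (11 - a) < 29) ∧
    (∀ a, 3 + 1 ≤ a → 3 + 1 ≤ 12 - a → maxContacts 3 a + maxContacts 3 (12 - a) < 32) ∧
    (∀ a, 4 + 1 ≤ a → 4 + 1 ≤ 13 - a → maxContacts 3 a + maxContacts 3 (13 - a) < 37) := by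
  refine ⟨?_, ?_, ?_, ?_, ?_, ?_⟩
  · intro a h1 h2
    have h3 : a ≤ 4 := by omega
    interval_cases a
    norm_num [maxContacts_three_four]
  · intro a h1 h2
    omega
  · intro a h1 h2
    have h3 : a ≤ 6 := by omega
    interval_cases a <;> norm_num [maxContacts_three_four, maxContacts_three_five, maxContacts_three_six]
  · intro a h1 h2
    have h3 : a ≤ 6 := by omega
    interval_cases a <;> norm_num [maxContacts_three_five, maxContacts_three_six]
  · intro a h1 h2
    have h3 : a ≤ 8 := by omega
    interval_cases a <;>
      norm_num [maxContacts_three_four, maxContacts_three_five, maxContacts_three_six, maxContacts_three_seven_eq,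
        maxContacts_three_eight_eq]
  · intro a h1 h2
    have h3 : a ≤ 8 := by omega
    interval_cases a <;>
      norm_num [maxContacts_three_five, maxContacts_three_six, maxContacts_three_seven_eq, maxContacts_three_eight_eq]

/-- **The complete-list hypotheses of the cone certificates may be read over CONNECTED graphs** (as the sweeps enumerate
them): for each stratum used, the connected statement implies the full one, unconditionally. [folklore] -/
theorem completeList_of_conn_strata :
    (∀ L, CompleteListHypothesisConn 3 18 8 L → CompleteListHypothesis 3 18 8 L) ∧
    (∀ L, CompleteListHypothesisConn 4 21 9 L → CompleteListHypothesis 4 21 9 L) ∧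
    (∀ L, CompleteListHypothesisConn 3 24 10 L → CompleteListHypothesis 3 24 10 L) ∧
    (∀ L, CompleteListHypothesisConn 3 25 10 L → CompleteListHypothesis 3 25 10 L) ∧
    (∀ L, CompleteListHypothesisConn 4 29 11 L → CompleteListHypothesis 4 29 11 L) ∧
    (∀ L, CompleteListHypothesisConn 3 32 12 L → CompleteListHypothesis 3 32 12 L) ∧
    (∀ L, CompleteListHypothesisConn 3 33 12 L → CompleteListHypothesis 3 33 12 L) := by
  obtain ⟨h8, h9, h10, h11, h12, h13⟩ := dense_strata
  exact ⟨fun L h => CompleteListHypothesis.of_conn (by norm_num) h8 h,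
    fun L h => CompleteListHypothesis.of_conn (by norm_num) h9 h,
    fun L h => CompleteListHypothesis.of_conn (by norm_num) h10 h,
    fun L h => CompleteListHypothesis.of_conn (by norm_num) (fun a h1 h2 => by have := h10 a h1 h2; omega) h,
    fun L h => CompleteListHypothesis.of_conn (by norm_num) h11 h,
    fun L h => CompleteListHypothesis.of_conn (by norm_num) h12 h,
    fun L h => CompleteListHypothesis.of_conn (by norm_num) (fun a h1 h2 => by have := h12 a h1 h2; omega) h⟩

/-- Likewise the kill strata read over connected graphs: `GSH(d, e, n)` from the connected-only statement, for
`(d, e, n) ∈ {(4,22,9), (5,26,10), (5,30,11), (5,34,12), (4,37,13)}`. [folklore] -/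
theorem graphStratum_of_conn_strata :
    (CompleteListHypothesisConn 4 22 9 ∅ → GraphStratumHypothesis 4 22 9) ∧
    (CompleteListHypothesisConn 5 26 10 ∅ → GraphStratumHypothesis 5 26 10) ∧
    (CompleteListHypothesisConn 5 30 11 ∅ → GraphStratumHypothesis 5 30 11) ∧
    (CompleteListHypothesisConn 5 34 12 ∅ → GraphStratumHypothesis 5 34 12) ∧
    (CompleteListHypothesisConn 4 37 13 ∅ → GraphStratumHypothesis 4 37 13) := by
  obtain ⟨-, h9, h10, h11, h12, h13⟩ := dense_strata
  exact ⟨fun h => graphStratumHypothesis_of_conn (by norm_num) (fun a h1 h2 => by have := h9 a h1 h2; omega) h,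
    fun h => graphStratumHypothesis_of_conn (by norm_num) (fun a h1 h2 => by have := h10 a (by omega) (by omega); omega) h,
    fun h => graphStratumHypothesis_of_conn (by norm_num) (fun a h1 h2 => by have := h11 a (by omega) (by omega); omega) h,
    fun h => graphStratumHypothesis_of_conn (by norm_num) (fun a h1 h2 => by have := h12 a (by omega) (by omega); omega) h,
    fun h => graphStratumHypothesis_of_conn (by norm_num) h13 h⟩

end Summit.Ventures.Crystal3D
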